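import Summits.MatrixMultiplication.MatrixMultiplication.Theorems.AbelianSTPPCensusTCStatDefs

/-!
# T_C static certificate, orders `628 … 2880` (theory's t*-indexed linear checker at `τ = 12/5`): kernel evaluation, the shape checks, volumes `2640 … 2880`

Cell mm-stpp (rung F-M1), tier T_C = «beat `2.4`»; checker in `AbelianSTPPCensusTCStatDefs.lean`, table in `AbelianSTPPCensusTCStatData.lean`
(pattern: theory g12's `AbelianSTPPCensusTAStatCCk*.lean`).  `decide` with kernel reduction (standard axioms; no `native_decide`), `Elab.async false`;
consumed by `TCStat.checkV_sound` / `TCStat.domV_sound` in the leaf `AbelianSTPPCensusLeafTC2880Closed.lean`.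
the shape checks, volumes `2640 … 2880` THIS IS NOT: arithmetic on shape lists only; no statement about STPP families or `ω`.
-/

set_option linter.dupNamespace false
set_option autoImplicit false
set_option Elab.async false

namespace Summit.MatrixMultiplication.MatrixMultiplication.Theorems.TCStat

set_option maxHeartbeats 0 in
/-- Check chunk: every sorted candidate shape of the volumes `2640 … 2705` passes `checkShape` (39712 (shape, bucket) checks). [original] -/
theorem ck2640 : TCStat.checkV 66 2640 = true := by decide +kernel

set_option maxHeartbeats 0 in
/-- Check chunk: every sorted candidate shape of the volumes `2706 … 2880` passes `checkShape` (38079 (shape, bucket) checks). [original] -/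
theorem ck2706 : TCStat.checkV 175 2706 = true := by decide +kernel

end Summit.MatrixMultiplication.MatrixMultiplication.Theorems.TCStat
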